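import Literature.AlgebraicGeometry.Resolution.PresentationExt
import Mathlib.Algebra.Module.FinitePresentation
import Mathlib.Algebra.Module.LocalizedModule.Submodule
import Mathlib.RingTheory.Localization.Module
import HarnessLib

/-!
# `Ext¹` by presentations commutes with localization

Topic: `Literature/AlgebraicGeometry/Resolution` (input for the localization-compatibility of the
`Ext`-annihilator ideals of Macaulayfication: with `ExtAnnihilatorIndependence.lean` and
`AnnihilatorLocalization.lean` it shows that `𝔠 = ∏ Ann Ext^q` localizes, `𝔠(M_S) = 𝔠(M) R_S`).

Setting: `R → R_S` a localization (`IsLocalization S Rₛ`); a presentation kernel `ι : K → P` over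
`R` with `K`, `P` finitely presented, and one `ι' : K' → P'` over `R_S`, together with
localization maps `f_K : K → K'`, `f_P : P → P'` (`IsLocalizedModule S`) compatible with `ι, ι'`.

* the localization map `θ_K : K^* → (K')^*` of duals is Mathlib's
  `IsLocalizedModule.mapExtendScalars` (a localization map since `K` is finitely presented);
  `PresExt.mapExtendScalars_dual_comp` — naturality `θ_K(ψ ∘ ι) = θ_P(ψ) ∘ ι'`;
* `PresExt.localized'_range_dualMap` — `im(ι^*)` localizes to `im(ι'^*)`;
* `PresExt.isLocalizedModule_ELocalize` — **`E(ι) → E(ι')` is a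
  localization map**: `E(ι') = E(ι)_S`, i.e. `Ext¹` commutes with localization for finitely
  presented modules.

[cite: Matsumura1987, Thm. 7.11 (`Hom` and flat base change for finitely presented modules);
folklore]
-/

noncomputable section

open Module

universe u

namespace Literature.AlgebraicGeometry.Resolution

namespace PresExt

variable {R : Type u} [CommRing R] (S : Submonoid R) (Rₛ : Type u) [CommRing Rₛ] [Algebra R Rₛ]
  [IsLocalization S Rₛ]
variable {K P : Type u} [AddCommGroup K] [Module R K] [AddCommGroup P] [Module R P]
  [Module.FinitePresentation R K] [Module.FinitePresentation R P]
variable {K' P' : Type u} [AddCommGroup K'] [Module R K'] [Module Rₛ K'] [IsScalarTower R Rₛ K']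
  [AddCommGroup P'] [Module R P'] [Module Rₛ P'] [IsScalarTower R Rₛ P']
variable (fK : K →ₗ[R] K') [IsLocalizedModule S fK] (fP : P →ₗ[R] P') [IsLocalizedModule S fP]

/-! The localization map of duals `θ_K : K^* → (K_S)^*`, `ψ ↦ (its `R_S`-linear extension)`, is
Mathlib's `IsLocalizedModule.mapExtendScalars S f_K (Algebra.linearMap R R_S) R_S`; it is a
localization map when `K` is finitely presented
(`Module.FinitePresentation.isLocalizedModule_mapExtendScalars`). -/

omit [Module.FinitePresentation R K] in
/-- `θ_K(ψ)(f_K y) = ψ(y)/1`. [folklore] -/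
theorem mapExtendScalars_dual_apply_apply (ψ : Dual R K) (y : K) :
    IsLocalizedModule.mapExtendScalars S fK (Algebra.linearMap R Rₛ) Rₛ ψ (fK y) = algebraMap R Rₛ (ψ y) := by
  change IsLocalizedModule.map S fK (Algebra.linearMap R Rₛ) ψ (fK y) = _
  rw [IsLocalizedModule.map_apply]
  rfl

variable (ι : K →ₗ[R] P) (ι' : K' →ₗ[Rₛ] P') (hcompat : ∀ y, ι' (fK y) = fP (ι y))

omit [Module.FinitePresentation R K] [Module.FinitePresentation R P] in
include hcompat in
/-- **Naturality**: `θ_K(ψ ∘ ι) = θ_P(ψ) ∘ ι'` (both are `R_S`-linear maps `K_S → R_S` taking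
`f_K y ↦ ψ(ι y)/1`). [folklore] -/
theorem mapExtendScalars_dual_comp (ψ : Dual R P) :
    IsLocalizedModule.mapExtendScalars S fK (Algebra.linearMap R Rₛ) Rₛ (ψ ∘ₗ ι) = (IsLocalizedModule.mapExtendScalars S fP (Algebra.linearMap R Rₛ) Rₛ ψ) ∘ₗ ι' := by
  apply LinearMap.restrictScalars_injective R
  apply IsLocalizedModule.ext S fK (IsLocalizedModule.map_units (Algebra.linearMap R Rₛ))
  ext y
  simp only [LinearMap.coe_comp, LinearMap.coe_restrictScalars, Function.comp_apply]
  rw [mapExtendScalars_dual_apply_apply, hcompat, mapExtendScalars_dual_apply_apply]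
  rfl

include hcompat in
/-- **`im(ι^*)` localizes to `im(ι'^*)`.** [folklore] -/
theorem localized'_range_dualMap :
    (LinearMap.range ι.dualMap).localized' Rₛ S (IsLocalizedModule.mapExtendScalars S fK (Algebra.linearMap R Rₛ) Rₛ) =
      LinearMap.range ι'.dualMap := by
  apply le_antisymm
  · rintro x hx
    rw [Submodule.mem_localized'] at hx
    obtain ⟨_, ⟨ψ, rfl⟩, s, hs⟩ := hx
    -- `s • x = θ_K(ψ ∘ ι) = θ_P(ψ) ∘ ι'`, so `x = (u • θ_P ψ) ∘ ι'` with `u = 1/s`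
    rw [IsLocalizedModule.mk'_eq_iff] at hs
    change IsLocalizedModule.mapExtendScalars S fK (Algebra.linearMap R Rₛ) Rₛ (ψ ∘ₗ ι) = s • x at hs
    rw [mapExtendScalars_dual_comp S Rₛ fK fP ι ι' hcompat] at hs
    refine ⟨IsLocalization.mk' Rₛ (1 : R) s • IsLocalizedModule.mapExtendScalars S fP (Algebra.linearMap R Rₛ) Rₛ ψ, ?_⟩
    rw [map_smul, LinearMap.dualMap_apply', hs, Submonoid.smul_def, ← algebraMap_smul Rₛ (s : R) x,
      ← mul_smul, IsLocalization.mk'_spec, map_one, one_smul]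
  · rintro _ ⟨φ', rfl⟩
    obtain ⟨⟨ψ, s⟩, hψ⟩ := IsLocalizedModule.mk'_surjective S (IsLocalizedModule.mapExtendScalars S fP (Algebra.linearMap R Rₛ) Rₛ) φ'
    simp only [Function.uncurry_apply_pair] at hψ
    rw [Submodule.mem_localized']
    refine ⟨ι.dualMap ψ, ⟨ψ, rfl⟩, s, ?_⟩
    rw [IsLocalizedModule.mk'_eq_iff] at hψ ⊢
    change IsLocalizedModule.mapExtendScalars S fK (Algebra.linearMap R Rₛ) Rₛ (ψ ∘ₗ ι) = s • ι'.dualMap φ'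
    rw [mapExtendScalars_dual_comp S Rₛ fK fP ι ι' hcompat, hψ, LinearMap.dualMap_apply']
    rfl

include hcompat in
/-- **`Ext¹` commutes with localization**: the map `E(ι) → E(ι')` induced by `θ_K` on
`K^*/im(ι^*)` is a localization map at `S` (`E(ι') ≅ E(ι)_S`), for finitely presented `K`, `P`.
[cite: Matsumura1987, Thm. 7.11] -/
theorem isLocalizedModule_ELocalize :
    IsLocalizedModule S
      (((Submodule.quotEquivOfEq _ _
          (localized'_range_dualMap S Rₛ fK fP ι ι' hcompat)).restrictScalars R).toLinearMap ∘ₗ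
        (LinearMap.range ι.dualMap).toLocalizedQuotient' Rₛ S (IsLocalizedModule.mapExtendScalars S fK (Algebra.linearMap R Rₛ) Rₛ) :
          E ι →ₗ[R] E ι') :=
  IsLocalizedModule.of_linearEquiv S _ _

end PresExt

end Literature.AlgebraicGeometry.Resolution

end
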